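import Summits.KontsevichZagierPeriods.KontsevichZagierPeriods.Theorems.TerasomaMultiplicationBetaCancellationStubWeightMul
import Summits.KontsevichZagierPeriods.KontsevichZagierPeriods.Theorems.TerasomaMultiplicationBetaCancellationStubRegionRestrict
import Summits.KontsevichZagierPeriods.KontsevichZagierPeriods.Theorems.TerasomaMultiplicationBetaCancellationStubWeight2Exists

/-!
# `BetaCancellation` (stmt-KontsevichZagierPeriods-13633), line `dirichlet-companion-to-pi` — stub `stub_weight2Mul`

**The two-coordinate multiplier maps weight-preserving relations to relations.** Let
`h : ℝ → ℝ → ℝ` be a weight of the two disc coordinates with `x ↦ h (x 0) (x 1)` `ℚ`-semialgebraic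
on `ℝ²`, such that every representation `r = [t, f]` of dimension `k + 2 ≥ 2` has the weighted
companion `[t, h (z 0) (z 1) · f]`, and let `M : FormalRep →+ FormalRep` be any additive
endomorphism which kills the generators of dimension `0` and `1` and sends the generator `[r]` of a
representation of dimension `k + 2` to `[s]` whenever `s` is the weighted companion of `r` (same
domain, integrand multiplied by `h (z 0) (z 1)`). Then `M` maps the subgroup generated by the
*weight-preserving generators* — all domain- and integrand-additivity instances (`KZ.domainAddRel`,
`KZ.integrandAddRel`), the changes of variables `Φ` on `(n+2)`-dimensional representations with
`h (Φ x 0) (Φ x 1) = h (x 0) (x 1)` on the domain, and the Newton–Leibniz moves `of r − of r'` with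
`r : IntegralRep (n + 3)`, `r' : IntegralRep (n + 2)` (base of dimension `≥ 2`) — into
`KZ.relations`.

Proof. The two-coordinate version of `stub_weightMul`
(`TerasomaMultiplicationBetaCancellationStubWeightMul.lean`), generator by generator
(`AddSubgroup.closure_le` for `relations.comap M`), with the additivity and substitution steps
stated once and for all for an arbitrary weight function `W` on `ℝᵏ`: a weighted additivity
instance is an additivity instance (`weight2Mul_domainAddRel`, `weight2Mul_integrandAddRel`:
multiply the pointwise identities by `W z`; in dimensions `0` and `1` the image is `0`); a
`W`-preserving change of variables is a change of variables between the weighted companions, since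
`W x · (f' (Φ x) · |det Φ' x|) = (W (Φ x) · f' (Φ x)) · |det Φ' x|`
(`weight2Mul_changeOfVariablesRel`); a Newton–Leibniz move over a base of dimension `≥ 2` (unfolded
from the verbatim dimension-pinned set by `regionRestrict_mem_newtonLeibnizRel_iff`) becomes the
Newton–Leibniz move with primitive `h (z 0) (z 1) · F z`, because both disc coordinates are base
coordinates, `(Fin.snoc x t) 0 = x 0` and `(Fin.snoc x t) 1 = x 1`, so the weight is constant along
each fibre (`weight2Mul_newtonLeibnizRel`; the new primitive is `ℚ`-semialgebraic as a product,
`IsSemialgebraicFunOn.mul_holds` with the coordinate transport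
`weight2Exists_isSemialgebraicFunOn_coord` of the hypothesis on `h`,
`TerasomaMultiplicationBetaCancellationStubWeight2Exists.lean`). `M` is evaluated on generators
through its pinning hypotheses only. No definitions; sorry-free;
axioms ⊆ {propext, Classical.choice, Quot.sound}.

References: M. Kontsevich, D. Zagier, *Periods* (2001), §1.2 rules (1)–(3); J. Ayoub, *Une version
relative de la conjecture des périodes de Kontsevich–Zagier*, Ann. of Math. 181 (2015), §1.
-/

noncomputable section

-- `Summit.KontsevichZagierPeriods.KontsevichZagierPeriods.…` is the tree's mandated layout (single-conjunct summit).
set_option linter.dupNamespace false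

namespace Summit.KontsevichZagierPeriods.KontsevichZagierPeriods.BetaCancellationLine

open Set
open Literature.NumberTheory.Transcendental
open Literature.NumberTheory.Transcendental.KZ

/-! ### Multiplication by a weight preserves the weight-preserving generators -/

/-- Multiplying a domain-additivity instance `[r] − [r₁] − [r₂]` by a weight `W z` (same domains,
each integrand multiplied by `W z`) gives a domain-additivity instance.
[cite: KontsevichZagier2001, §1.2 rule (1)] -/
theorem weight2Mul_domainAddRel {k : ℕ} (W : (Fin k → ℝ) → ℝ) {r r₁ r₂ s s₁ s₂ : IntegralRep k}
    (hdom : r.domain = r₁.domain ∪ r₂.domain)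
    (hnull : MeasureTheory.volume (r₁.domain ∩ r₂.domain) = 0)
    (h₁ : EqOn r.integrand r₁.integrand r₁.domain) (h₂ : EqOn r.integrand r₂.integrand r₂.domain)
    (hs : s.domain = r.domain) (hsi : s.integrand = fun z => W z * r.integrand z)
    (hs₁ : s₁.domain = r₁.domain) (hs₁i : s₁.integrand = fun z => W z * r₁.integrand z)
    (hs₂ : s₂.domain = r₂.domain) (hs₂i : s₂.integrand = fun z => W z * r₂.integrand z) :
    of s - of s₁ - of s₂ ∈ domainAddRel := by
  refine ⟨k, s, s₁, s₂, ?_, ?_, ?_, ?_, rfl⟩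
  · rw [hs, hs₁, hs₂, hdom]
  · rw [hs₁, hs₂]
    exact hnull
  · rw [hsi, hs₁i, hs₁]
    intro z hz
    show W z * r.integrand z = W z * r₁.integrand z
    rw [h₁ hz]
  · rw [hsi, hs₂i, hs₂]
    intro z hz
    show W z * r.integrand z = W z * r₂.integrand z
    rw [h₂ hz]

/-- Multiplying an integrand-additivity instance `[r] − [r₁] − [r₂]` by a weight `W z` gives an
integrand-additivity instance (`W · (f₁ + f₂) = W · f₁ + W · f₂`).
[cite: KontsevichZagier2001, §1.2 rule (1)] -/
theorem weight2Mul_integrandAddRel {k : ℕ} (W : (Fin k → ℝ) → ℝ) {r r₁ r₂ s s₁ s₂ : IntegralRep k}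
    (h₁ : r₁.domain = r.domain) (h₂ : r₂.domain = r.domain)
    (hadd : EqOn r.integrand (r₁.integrand + r₂.integrand) r.domain)
    (hs : s.domain = r.domain) (hsi : s.integrand = fun z => W z * r.integrand z)
    (hs₁ : s₁.domain = r₁.domain) (hs₁i : s₁.integrand = fun z => W z * r₁.integrand z)
    (hs₂ : s₂.domain = r₂.domain) (hs₂i : s₂.integrand = fun z => W z * r₂.integrand z) :
    of s - of s₁ - of s₂ ∈ integrandAddRel := by
  refine ⟨k, s, s₁, s₂, ?_, ?_, ?_, rfl⟩
  · rw [hs₁, hs, h₁]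
  · rw [hs₂, hs, h₂]
  · rw [hsi, hs₁i, hs₂i, hs]
    intro z hz
    show W z * r.integrand z = W z * r₁.integrand z + W z * r₂.integrand z
    rw [hadd hz, Pi.add_apply, mul_add]

/-- **A weight-preserving change of variables is a change of variables between the weighted
companions**: with `W (Φ x) = W x` on `r.domain`,
`W x · f x = W x · (f' (Φ x) · |det Φ' x|) = (W (Φ x) · f' (Φ x)) · |det Φ' x|`; the map `Φ`, its
derivative, injectivity and the image clause are unchanged.
[cite: KontsevichZagier2001, §1.2 rule (2)] -/
theorem weight2Mul_changeOfVariablesRel {k : ℕ} (W : (Fin k → ℝ) → ℝ) {r r' s s' : IntegralRep k}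
    {Φ : (Fin k → ℝ) → (Fin k → ℝ)} {Φ' : (Fin k → ℝ) → (Fin k → ℝ) →L[ℝ] (Fin k → ℝ)}
    (hΦ : IsSemialgebraicMapOn ℚ r.domain Φ)
    (hΦ' : ∀ x ∈ r.domain, HasFDerivWithinAt Φ (Φ' x) r.domain x) (hinj : InjOn Φ r.domain)
    (hdom : r'.domain = Φ '' r.domain)
    (hf : ∀ x ∈ r.domain, r.integrand x = r'.integrand (Φ x) * |(Φ' x).det|)
    (hW : ∀ x ∈ r.domain, W (Φ x) = W x)
    (hs : s.domain = r.domain) (hsi : s.integrand = fun z => W z * r.integrand z)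
    (hs' : s'.domain = r'.domain) (hs'i : s'.integrand = fun z => W z * r'.integrand z) :
    of s - of s' ∈ changeOfVariablesRel := by
  refine ⟨k, s, s', Φ, Φ', ?_, ?_, ?_, ?_, fun x hx => ?_, rfl⟩
  · rw [hs]
    exact hΦ
  · rw [hs]
    exact hΦ'
  · rw [hs]
    exact hinj
  · rw [hs', hs, hdom]
  · rw [hs] at hx
    rw [hsi, hs'i]
    show W x * r.integrand x = W (Φ x) * r'.integrand (Φ x) * |(Φ' x).det|
    rw [hf x hx, hW x hx, mul_assoc]

/-- The second coordinate is a base coordinate of a band over a base of dimension `≥ 2`: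
`(Fin.snoc x t) 1 = x 1`. [folklore] -/
theorem weight2Mul_snoc_one {n : ℕ} (x : Fin (n + 2) → ℝ) (t : ℝ) :
    (Fin.snoc x t : Fin (n + 3) → ℝ) 1 = x 1 := by
  show (Fin.snoc x t : Fin (n + 3) → ℝ) (Fin.castSucc 1) = x 1
  exact Fin.snoc_castSucc (α := fun _ => ℝ) t x 1

/-- **Multiplying a Newton–Leibniz move over a base of dimension `≥ 2` by the two-coordinate weight
gives a Newton–Leibniz move**: the weight `h (z 0) (z 1)` only depends on the base coordinates
`(Fin.snoc x t) 0 = x 0`, `(Fin.snoc x t) 1 = x 1`, so it is constant along each fibre; the new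
primitive `G z = h (z 0) (z 1) · F z` is `ℚ`-semialgebraic on the band (product of semialgebraic
functions), fibrewise continuous with derivative `h (x 0) (x 1) · f`, and its boundary values give
`h (x 0) (x 1) · (F (x, b x) − F (x, a x))`. [cite: KontsevichZagier2001, §1.2 rule (3)] -/
theorem weight2Mul_newtonLeibnizRel {n : ℕ} {h : ℝ → ℝ → ℝ}
    (hh : IsSemialgebraicFunOn ℚ (Set.univ : Set (Fin 2 → ℝ)) (fun x => h (x 0) (x 1)))
    {r s : IntegralRep (n + 3)} {r' s' : IntegralRep (n + 2)} {α β : (Fin (n + 2) → ℝ) → ℝ}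
    {F : (Fin (n + 3) → ℝ) → ℝ}
    (hF : IsSemialgebraicFunOn ℚ r.domain F)
    (hα : IsSemialgebraicFunOn ℚ r'.domain α) (hβ : IsSemialgebraicFunOn ℚ r'.domain β)
    (hle : ∀ x ∈ r'.domain, α x ≤ β x)
    (hband : r.domain = {z | (Fin.init z : Fin (n + 2) → ℝ) ∈ r'.domain ∧
      α (Fin.init z) ≤ z (Fin.last (n + 2)) ∧ z (Fin.last (n + 2)) ≤ β (Fin.init z)})
    (hcont : ∀ x ∈ r'.domain, ContinuousOn (fun t : ℝ => F (Fin.snoc x t)) (Icc (α x) (β x)))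
    (hderiv : ∀ x ∈ r'.domain, ∀ t ∈ Ioo (α x) (β x),
      HasDerivAt (fun s : ℝ => F (Fin.snoc x s)) (r.integrand (Fin.snoc x t)) t)
    (hr' : ∀ x ∈ r'.domain, r'.integrand x = F (Fin.snoc x (β x)) - F (Fin.snoc x (α x)))
    (hs : s.domain = r.domain) (hsi : s.integrand = fun z => h (z 0) (z 1) * r.integrand z)
    (hs' : s'.domain = r'.domain) (hs'i : s'.integrand = fun z => h (z 0) (z 1) * r'.integrand z) :
    of s - of s' ∈ newtonLeibnizRel := by
  have hG : IsSemialgebraicFunOn ℚ s.domain (fun z : Fin (n + 3) → ℝ => h (z 0) (z 1) * F z) := by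
    rw [hs]
    exact IsSemialgebraicFunOn.mul_holds
      ((weight2Exists_isSemialgebraicFunOn_coord hh (0 : Fin (n + 3)) 1).mono (subset_univ _)
        r.isSemialgebraic_domain) hF
  refine ⟨n + 2, s, s', α, β, fun z => h (z 0) (z 1) * F z, hG, ?_, ?_, ?_, ?_, ?_, ?_, ?_, rfl⟩
  · rw [hs']
    exact hα
  · rw [hs']
    exact hβ
  · rw [hs']
    exact hle
  · rw [hs, hs', hband]
  · rw [hs']
    intro x hx
    simp only [weightMul_snoc_zero, weight2Mul_snoc_one]
    exact (hcont x hx).const_smul (h (x 0) (x 1))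
  · rw [hs', hsi]
    intro x hx t ht
    simp only [weightMul_snoc_zero, weight2Mul_snoc_one]
    exact (hderiv x hx t ht).const_mul (h (x 0) (x 1))
  · rw [hs', hs'i]
    intro x hx
    show h (x 0) (x 1) * r'.integrand x =
      h ((Fin.snoc x (β x) : Fin (n + 3) → ℝ) 0) ((Fin.snoc x (β x) : Fin (n + 3) → ℝ) 1) *
          F (Fin.snoc x (β x)) -
        h ((Fin.snoc x (α x) : Fin (n + 3) → ℝ) 0) ((Fin.snoc x (α x) : Fin (n + 3) → ℝ) 1) *
          F (Fin.snoc x (α x))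
    rw [weightMul_snoc_zero, weight2Mul_snoc_one, weightMul_snoc_zero, weight2Mul_snoc_one, hr' x hx,
      mul_sub]

/-! ### The two-coordinate multiplier maps weight-preserving relations to relations -/

/-- STUB (the two-coordinate multiplier maps weight-preserving relations to relations): any additive
`M` killing the generators of dimension `0` and `1` and pinned by `M [r] = [r.domain, h(z 0, z 1)·f]`
in dimension `≥ 2` maps the closure of additivity, the `h`-PRESERVING substitutions of
`(n+2)`-dimensional representations and Newton–Leibniz over bases of dimension `≥ 2` into
`relations`, generator by generator. [folklore] -/
theorem stub_weight2Mul :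
    ∀ (h : ℝ → ℝ → ℝ), IsSemialgebraicFunOn ℚ (Set.univ : Set (Fin 2 → ℝ)) (fun x => h (x 0) (x 1)) →
    (∀ (k : ℕ) (r : IntegralRep (k + 2)),
      ∃ s : IntegralRep (k + 2), s.domain = r.domain ∧
        s.integrand = fun z => h (z 0) (z 1) * r.integrand z) →
    ∀ (M : FormalRep →+ FormalRep),
      (∀ r : IntegralRep 0, M (of r) = 0) → (∀ r : IntegralRep 1, M (of r) = 0) →
      (∀ (k : ℕ) (r s : IntegralRep (k + 2)), s.domain = r.domain →
          (s.integrand = fun z => h (z 0) (z 1) * r.integrand z) → M (of r) = of s) →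
      ∀ x ∈ AddSubgroup.closure (domainAddRel ∪ integrandAddRel ∪
          {x | ∃ (n : ℕ) (r r' : IntegralRep (n + 2)) (Φ : (Fin (n + 2) → ℝ) → (Fin (n + 2) → ℝ))
              (Φ' : (Fin (n + 2) → ℝ) → (Fin (n + 2) → ℝ) →L[ℝ] (Fin (n + 2) → ℝ)),
            IsSemialgebraicMapOn ℚ r.domain Φ ∧
            (∀ x ∈ r.domain, HasFDerivWithinAt Φ (Φ' x) r.domain x) ∧ Set.InjOn Φ r.domain ∧
            r'.domain = Φ '' r.domain ∧
            (∀ x ∈ r.domain, r.integrand x = r'.integrand (Φ x) * |(Φ' x).det|) ∧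
            (∀ x ∈ r.domain, h (Φ x 0) (Φ x 1) = h (x 0) (x 1)) ∧
            x = of r - of r'} ∪
          {x | x ∈ newtonLeibnizRel ∧ ∃ (n : ℕ) (r : IntegralRep (n + 3)) (r' : IntegralRep (n + 2)),
            x = of r - of r'}),
        M x ∈ relations := by
  intro h hh hex M h0 h1 hpin x hx
  refine (AddSubgroup.closure_le (relations.comap M)).mpr ?_ hx
  rintro y (((hy | hy) | hy) | hy)
  · obtain ⟨k, r, r₁, r₂, hdom, hnull, h₁, h₂, rfl⟩ := hy
    rw [AddSubgroup.coe_comap, mem_preimage, map_sub, map_sub]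
    rcases k with _ | _ | k
    · rw [h0 r, h0 r₁, h0 r₂, sub_zero, sub_zero]
      exact relations.zero_mem
    · rw [h1 r, h1 r₁, h1 r₂, sub_zero, sub_zero]
      exact relations.zero_mem
    · obtain ⟨s, hs, hsi⟩ := hex k r
      obtain ⟨s₁, hs₁, hs₁i⟩ := hex k r₁
      obtain ⟨s₂, hs₂, hs₂i⟩ := hex k r₂
      rw [hpin k r s hs hsi, hpin k r₁ s₁ hs₁ hs₁i, hpin k r₂ s₂ hs₂ hs₂i]
      exact domainAddRel_subset_relations
        (weight2Mul_domainAddRel (fun z => h (z 0) (z 1)) hdom hnull h₁ h₂ hs hsi hs₁ hs₁i hs₂ hs₂i)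
  · obtain ⟨k, r, r₁, r₂, h₁, h₂, hadd, rfl⟩ := hy
    rw [AddSubgroup.coe_comap, mem_preimage, map_sub, map_sub]
    rcases k with _ | _ | k
    · rw [h0 r, h0 r₁, h0 r₂, sub_zero, sub_zero]
      exact relations.zero_mem
    · rw [h1 r, h1 r₁, h1 r₂, sub_zero, sub_zero]
      exact relations.zero_mem
    · obtain ⟨s, hs, hsi⟩ := hex k r
      obtain ⟨s₁, hs₁, hs₁i⟩ := hex k r₁
      obtain ⟨s₂, hs₂, hs₂i⟩ := hex k r₂
      rw [hpin k r s hs hsi, hpin k r₁ s₁ hs₁ hs₁i, hpin k r₂ s₂ hs₂ hs₂i]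
      exact integrandAddRel_subset_relations
        (weight2Mul_integrandAddRel (fun z => h (z 0) (z 1)) h₁ h₂ hadd hs hsi hs₁ hs₁i hs₂ hs₂i)
  · obtain ⟨k, r, r', Φ, Φ', hΦ, hΦ', hinj, hdom, hf, hw', rfl⟩ := hy
    rw [AddSubgroup.coe_comap, mem_preimage, map_sub]
    obtain ⟨s, hs, hsi⟩ := hex k r
    obtain ⟨s', hs', hs'i⟩ := hex k r'
    rw [hpin k r s hs hsi, hpin k r' s' hs' hs'i]
    exact changeOfVariablesRel_subset_relations
      (weight2Mul_changeOfVariablesRel (fun z => h (z 0) (z 1)) hΦ hΦ' hinj hdom hf hw' hs hsi hs' hs'i)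
  · obtain ⟨k, r, r', α, β, F, hF, hα, hβ, hle, hband, hcont, hderiv, hr', rfl⟩ :=
      regionRestrict_mem_newtonLeibnizRel_iff.mp hy
    rw [AddSubgroup.coe_comap, mem_preimage, map_sub]
    obtain ⟨s, hs, hsi⟩ := hex (k + 1) r
    obtain ⟨s', hs', hs'i⟩ := hex k r'
    rw [hpin (k + 1) r s hs hsi, hpin k r' s' hs' hs'i]
    exact newtonLeibnizRel_subset_relations
      (weight2Mul_newtonLeibnizRel hh hF hα hβ hle hband hcont hderiv hr' hs hsi hs' hs'i)

end Summit.KontsevichZagierPeriods.KontsevichZagierPeriods.BetaCancellationLine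

end
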